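import Literature.AnabelianGeometry.EtaleTheta.ThetaCoversKummerTwistTemperedDefs
import HarnessLib

/-!
# The KUMMER-TWIST model of `ThetaCovers.TemperedCoverData` ([EtTh] §2), part 2: the orbicurve `C̲̲` of type
# `(1, l-torsΘ)±` (Def. 2.3) — the data `(Π_C̲, ι̲ = s r, E, S)` of Prop. 2.2 and `Π_C̲̲ = (S·E)·⟨ι̲⟩`

S. Mochizuki, *The étale theta function …*, Publ. RIMS **45** (2009) [MochizukiEtTh2009], §2, Def. 2.1 – Def. 2.3 (PDF pp.36–38).
abc-iut cell, seat abc-iut-f-141. CONSISTENCY WITNESS / TOY (continuation of `ThetaCoversKummerTwistTemperedDefs.lean`, same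
honest labels); PROOF-ONLY (0 definitions: the data are the `def`s `HpK`, `EK`, `SK`, `iotaK`, `PiCuuK` of the defs file).

In the model `Π_C = A × Ẑ` (coordinate `Φ : Π_C → (ℤ/l)³ ⋊ D_l`): `Π_C̲ := Φ⁻¹((ℤ/l)³ ⋊ {1, s r})`, `Π_X̲ = Π_C̲ ∩ Π_X = Φ⁻¹((ℤ/l)³ ⋊ 1)`,
**`ι̲ := s r`** (the reflection normalising `D_x`), `E := Φ⁻¹⟨(1, −1, 0)⟩` (the `(−1)`-eigenline of `s r` in the plane `z = 0`;
it meets the centre trivially), the splitting **`S := Φ⁻¹⟨g⟩`** of `D_x ↠ G_K = ℤ/l` (a genuine section this time), and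
`Π_C̲̲ := Φ⁻¹({y = −x} ⋊ {1, s r}) = (S · E) · ⟨ι̲⟩` — PROVED to be of type `(1, l-torsΘ)±` (`isTypeLTorsThetaPm_PiCuuK`), open, with
`Π_C̲̲ · Δ̄_Θ = Π_C̲`, `(Π_C̲̲ ∩ Π_X) · Δ̄_Θ = Π_X̲`.  [cite: MochizukiEtTh2009, Def 2.3 p.38]
-/

noncomputable section

namespace Literature.AnabelianGeometry.EtaleTheta

namespace ThetaCovers

/-! ## 0. One more toy fact: `Π_C̲̲-part · centre = Π_C̲-part` -/

namespace KummerWitness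

variable (l : ℕ)

/-- `Π_C̲̲-part · Δ̄_Θ-part = Π_C̲-part` in the toy. (toy bookkeeping; no claim about print) [cite: MochizukiEtTh2009, Def 2.3 p.38] -/
theorem kumCuu_sup_kumZ : kumCuu l ⊔ kumZ l = kumHp l := by
  refine le_antisymm (sup_le (kumCuu_le_kumHp l) (((kumZ_le_kumDx l).trans (kumDx_le_kumH l)).trans (kumH_le_kumHp l)))
    fun g hg => ?_
  have hle : kumXuu l ⊔ kumZ l ≤ kumCuu l ⊔ kumZ l := sup_le_sup_right (kumXuu_le_kumCuu l) _
  rcases hg with hg | hg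
  · exact hle (by rw [kumXuu_sup_kumZ]; exact hg)
  · have h1 : g * (iota l)⁻¹ ∈ kumCuu l ⊔ kumZ l := hle (by rw [kumXuu_sup_kumZ]; exact mul_iota_inv_mem_kumH l hg)
    have : g = g * (iota l)⁻¹ * iota l := by rw [inv_mul_cancel_right]
    rw [this]
    exact Subgroup.mul_mem _ h1 (Subgroup.mem_sup_left (iota_mem_kumCuu l))

end KummerWitness

namespace KummerModel

open Multiplicative KummerWitness Literature.AnabelianGeometry.SemiGraphs
  Literature.AnabelianGeometry.EtaleTheta.SettingModel TemperedModel

variable (l : ℕ)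

/-! ## 1. Coordinates of `ι̲` -/

/-- `Φ ι̲ = s r`. (toy bookkeeping) [cite: MochizukiEtTh2009, Prop 2.2 p.36] -/
@[simp] theorem PhiK_iotaK : PhiK l (iotaK l) = iota l := rfl

/-- `ι̲ ∉ Π_X`. (toy bookkeeping) [cite: MochizukiEtTh2009, Prop 2.2 p.36] -/
theorem iotaK_not_mem_PiXK : iotaK l ∉ PiXK l := fun h => iota_not_mem_kumPiX l h

/-- `ι̲ ∈ Π_C̲`. (toy bookkeeping) [cite: MochizukiEtTh2009, Prop 2.2 p.36] -/
theorem iotaK_mem_HpK : iotaK l ∈ HpK l := iota_mem_kumHp l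

/-- `ι̲ ∈ Δ_C = Ker(aug)`. (toy bookkeeping) [cite: MochizukiEtTh2009, Prop 2.2 p.36] -/
theorem iotaK_mem_ker_augK : iotaK l ∈ (augK l).ker := by
  rw [augK_ker, Subgroup.mem_comap, mem_ker_aug, PhiK_iotaK, ζ_iota]

/-- `ι̲² = 1` (through `(ι̲^tp)² = 1` in `Π^tp_C`). (toy bookkeeping) [cite: MochizukiEtTh2009, Prop 2.2 (iii) p.37] -/
theorem iotaK_mul_self : iotaK l * iotaK l = 1 := by
  have h : iotaG l * iotaG l = 1 := Prod.ext (Prod.ext (iota_mul_self l) (mul_one _)) (mul_one _)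
  rw [← toHatK_iotaG, ← map_mul, h, map_one]

/-! ## 2. `Π_X̲`, `E`, `Π_C̲̲` -/

/-- `Π_C̲ ∩ Π_X = Φ⁻¹((ℤ/l)³ ⋊ 1)`. (toy bookkeeping) [cite: MochizukiEtTh2009, Def 2.1 p.36] -/
theorem HpK_inf_eq : HpK l ⊓ PiXK l = (kumH l).comap (PhiK l) := by
  rw [HpK, PiXK, ← Subgroup.comap_inf, kumHp_inf_kumPiX]

/-- `Δ̄_Θ-preimage ⊆ Π_X̲`. (toy bookkeeping) [cite: MochizukiEtTh2009, Def 2.1 p.36] -/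
theorem barThetaK_le_HpK_inf : barThetaK l ≤ HpK l ⊓ PiXK l := by
  rw [HpK_inf_eq]
  exact Subgroup.comap_mono ((kumZ_le_kumDx l).trans (kumDx_le_kumH l))

/-- `D_x ⊆ Π_X̲`. (toy bookkeeping) [cite: MochizukiEtTh2009, Def 2.1 p.36] -/
theorem DxK_le_HpK_inf : DxK l ≤ HpK l ⊓ PiXK l := by
  rw [HpK_inf_eq]
  exact Subgroup.comap_mono (kumDx_le_kumH l)

/-- `E` is open. (toy bookkeeping) [cite: MochizukiEtTh2009, Prop 2.2 (i) p.37] -/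
theorem isOpen_EK : IsOpen (EK l : Set (PiCK l)) := by
  change IsOpen ((PhiK l) ⁻¹' (kumE l : Set (kumPiC l)))
  exact isOpen_preimage_PhiK l _

/-- `Π_C̲̲` is open. (toy bookkeeping) [cite: MochizukiEtTh2009, Def 2.3 p.38] -/
theorem isOpen_PiCuuK : IsOpen (PiCuuK l : Set (PiCK l)) := by
  change IsOpen ((PhiK l) ⁻¹' (kumCuu l : Set (kumPiC l)))
  exact isOpen_preimage_PhiK l _

/-! ## 3. The rotation-index character on `Π_X` and the type `(1, l-tors)±` of `Π_C̲` -/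

/-- The rotation character of the model, `Π_X → kumPiX → ℤ/l` (`rotChar ∘ Φ`), is onto. (toy bookkeeping)
[cite: MochizukiEtTh2009, Def 2.1 p.36] -/
theorem rotChar_comp_surjective :
    Function.Surjective ((rotChar l).comp ((PhiK l).subgroupComap (kumPiX l))) := by
  intro y
  obtain ⟨a, rfl⟩ := Multiplicative.ofAdd.surjective y
  obtain ⟨x, hx⟩ := PhiK_surjective l (SemidirectProduct.inr (DihedralGroup.r a))
  have hxX : x ∈ PiXK l := by
    change PhiK l x ∈ kumPiX l
    rw [hx]
    exact (mem_kumPiX l).mpr ⟨a, rfl⟩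
  refine ⟨⟨x, hxX⟩, ?_⟩
  change ofAdd (HeisenbergWitness.rotIdx l (PhiK l x).right) = ofAdd a
  rw [hx, SemidirectProduct.right_inr, HeisenbergWitness.rotIdx_r]

/-- `Π_X̲ · Δ_X = Π_X` in the model (`(w, r^i) = (w, 1)·(0, r^i)` lifted along `Φ`). (toy bookkeeping) [cite: MochizukiEtTh2009, Def 2.1 p.36] -/
theorem HpK_inf_sup_delta : (HpK l ⊓ PiXK l) ⊔ (PiXK l ⊓ (augK l).ker) = PiXK l := by
  rw [HpK_inf_eq, deltaK_eq, PiXK, Subgroup.comap_sup_eq _ _ _ (PhiK_surjective l), kumH_sup_delta]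

variable (hl : Odd l)

/-- **`Π_C̲` is of type `(1, l-tors)±`** in the model (Def. 2.1): `Π_X̲ = Π_C̲ ∩ Π_X` is the kernel of the rotation character
`Π_X ↠ ℤ/l`, contains `Δ̄_Θ-preimage` and `D_x`, `Π_X̲ · Δ_X = Π_X`, and `[Π_C̲ : Π_X̲] = 2`. [cite: MochizukiEtTh2009, Def 2.1 p.36] -/
theorem isTypeLTorsPm_HpK : (coverDataAx l hl).toCoverData.IsTypeLTorsPm (HpK l) := by
  refine ⟨⟨inf_le_right, ⟨(rotChar l).comp ((PhiK l).subgroupComap (kumPiX l)), rotChar_comp_surjective l,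
    fun g => ?_⟩, barThetaK_le_HpK_inf l, HpK_inf_sup_delta l, DxK_le_HpK_inf l⟩, ?_⟩
  · -- kernel of the rotation character
    change rotChar l ((PhiK l).subgroupComap (kumPiX l) g) = 1 ↔ (g : PiCK l) ∈ HpK l ⊓ PiXK l
    rw [KummerWitness.rotChar_eq_one_iff, HpK_inf_eq]
    rfl
  · -- `[Π_C̲ : Π_X̲] = 2`
    change (HpK l ⊓ PiXK l).relIndex (HpK l) = 2
    rw [HpK_inf_eq, HpK, Subgroup.relIndex_comap, Subgroup.map_comap_eq_self_of_surjective (PhiK_surjective l),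
      ← kumHp_inf_kumPiX]
    exact relIndex_kumH l

/-- `ι̲` is an inversion for `Π_C̲` (`ι̲ ∈ Π_C̲ ∩ Δ_C ∖ Π_X`). [cite: MochizukiEtTh2009, Prop 2.2 p.36] -/
theorem isInversion_iotaK : (coverDataAx l hl).toCoverData.IsInversion (HpK l) (iotaK l) :=
  ⟨iotaK_mem_HpK l, iotaK_mem_ker_augK l, iotaK_not_mem_PiXK l⟩

/-- **`E` is the `(−1)`-eigenspace datum `Im(s_ι)`** of Prop. 2.2 (i) for `(Π_X̲, Π_C̲, ι̲)` in the model.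
[cite: MochizukiEtTh2009, Prop 2.2 (i) p.37] -/
theorem isMinusEigen_EK : (coverDataAx l hl).toCoverData.IsMinusEigen (HpK l ⊓ PiXK l) (HpK l) (iotaK l) (EK l) := by
  refine ⟨barKerK_le_comap l _, ?_, ?_, ?_, ?_, ?_, ?_, ?_⟩
  · -- `E ⊆ Π_X̲ ∩ Δ_C`
    change EK l ≤ (HpK l ⊓ PiXK l) ⊓ (augK l).ker
    rw [HpK_inf_eq, augK_ker, ← Subgroup.comap_inf]
    exact Subgroup.comap_mono (kumE_le l)
  · -- normalised by `Π_X̲` (which is abelian modulo `Φ`)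
    intro g hg e he
    have hg1 : (PhiK l g).right = 1 := by
      have := (HpK_inf_eq l).le hg
      exact this
    change PhiK l (g * e * g⁻¹) ∈ kumE l
    rw [map_mul, map_mul, map_inv, conj_eq_of_right_eq_one l hg1 ((mem_kumE l).mp he).1]
    exact he
  · -- `E ∩ Δ̄_Θ = Ker`
    change EK l ⊓ barThetaK l = barKerK l
    rw [EK, barThetaK, ← Subgroup.comap_inf, kumE_inf_kumZ, MonoidHom.comap_bot]
    rfl
  · -- `E · Δ̄_Θ = Π_X̲ ∩ Δ_C`
    change EK l ⊔ barThetaK l = (HpK l ⊓ PiXK l) ⊓ (augK l).ker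
    rw [EK, barThetaK, Subgroup.comap_sup_eq _ _ _ (PhiK_surjective l), kumE_sup_kumZ, HpK_inf_eq, augK_ker,
      ← Subgroup.comap_inf]
  · -- `ι̲` acts by `−1` on `E` (modulo `Ker Φ`; in fact on the nose in the toy)
    intro e he
    change PhiK l (iotaK l * e * (iotaK l)⁻¹ * e) = 1
    rw [map_mul, map_mul, map_mul, map_inv, PhiK_iotaK]
    exact iota_conj_mul_self l he
  · -- `ι̲` acts by `+1` on `Δ̄_Θ`
    intro t ht
    change PhiK l (iotaK l * t * (iotaK l)⁻¹ * t⁻¹) = 1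
    rw [map_mul, map_mul, map_mul, map_inv, map_inv, PhiK_iotaK]
    exact z_central l (iota l) ht
  · -- `ι̲` normalises `E`
    intro e he
    change PhiK l (iotaK l * e * (iotaK l)⁻¹) ∈ kumE l
    rw [map_mul, map_mul, map_inv, PhiK_iotaK]
    exact iota_conj_mem_kumE l he

/-- **`S = Φ⁻¹⟨g⟩` is a splitting of `D̄_x ↠ G_K = ℤ/l`** in the model (a genuine one: `S ∩ Δ̄_Θ = Ker Φ`, `S ↠ ℤ/l`).
[cite: MochizukiEtTh2009, Prop 2.2 (ii) p.37] -/
theorem isSplitting_SK : (coverDataAx l hl).toCoverData.IsSplitting (SK l) := by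
  refine ⟨barKerK_le_comap l _, (Subgroup.comap_mono (kumS_le_kumDx l)).trans le_sup_left, ?_, fun t => ?_⟩
  · change SK l ⊓ barThetaK l = barKerK l
    rw [SK, barThetaK, ← Subgroup.comap_inf, kumS_inf_kumZ, MonoidHom.comap_bot]
    rfl
  · refine ⟨⟨(TK.inK l (KummerWitness.mk l 0 0 (toAdd t) 1) 1, 1),
      show KummerWitness.mk l 0 0 (toAdd t) 1 ∈ kumS l from ⟨rfl, rfl, rfl⟩⟩, ?_⟩
    rw [MonoidHom.restrict_apply]
    rfl

/-- `S · E = Φ⁻¹(Π_X̲̲-part)`. (toy bookkeeping) [cite: MochizukiEtTh2009, Def 2.3 p.38] -/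
theorem SK_sup_EK : SK l ⊔ EK l = (kumXuu l).comap (PhiK l) := by
  rw [SK, EK, Subgroup.comap_sup_eq _ _ _ (PhiK_surjective l), kumS_sup_kumE]

/-- **`Π_C̲̲ = (S · E) · ⟨ι̲⟩`** in the model (an element with `D_l`-part `s r` is `(x ι̲⁻¹) · ι̲`). (toy bookkeeping)
[cite: MochizukiEtTh2009, Def 2.3 p.38] -/
theorem PiCuuK_eq : PiCuuK l = (SK l ⊔ EK l) ⊔ Subgroup.zpowers (iotaK l) := by
  rw [SK_sup_EK]
  refine le_antisymm (fun x hx => ?_) (sup_le (Subgroup.comap_mono (kumXuu_le_kumCuu l)) ?_)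
  · have hx' : PhiK l x ∈ kumCuu l := hx
    rcases hx'.1 with h1 | h1
    · exact Subgroup.mem_sup_left (show PhiK l x ∈ kumXuu l from ⟨h1, hx'.2⟩)
    · have hy : x * (iotaK l)⁻¹ ∈ (kumXuu l).comap (PhiK l) := by
        change PhiK l (x * (iotaK l)⁻¹) ∈ kumXuu l
        rw [map_mul, map_inv, PhiK_iotaK]
        exact mul_iota_inv_mem_kumXuu l hx' h1
      have : x = x * (iotaK l)⁻¹ * iotaK l := by rw [inv_mul_cancel_right]
      rw [this]
      exact Subgroup.mul_mem _ (Subgroup.mem_sup_left hy) (Subgroup.mem_sup_right (Subgroup.mem_zpowers _))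
  · rw [Subgroup.zpowers_le]
    exact iota_mem_kumCuu l

/-- **`Π_C̲̲` is of type `(1, l-torsΘ)±`** in the Kummer-twist model (Def. 2.3 / Prop. 2.2 (iii)): the data `(Π_C̲, E, S, ι̲)` above
with `ι̲² = 1 ∈ Ker`. [cite: MochizukiEtTh2009, Def 2.3 p.38] -/
theorem isTypeLTorsThetaPm_PiCuuK : (coverDataAx l hl).toCoverData.IsTypeLTorsThetaPm (PiCuuK l) :=
  ⟨HpK l, EK l, SK l, iotaK l, isTypeLTorsPm_HpK l hl, isInversion_iotaK l hl,
    by rw [iotaK_mul_self]; exact (barKerK l).one_mem, isMinusEigen_EK l hl, isSplitting_SK l hl, PiCuuK_eq l⟩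

/-! ## 4. The members `Π_X̲̲, Π_X̲, Π_C̲` of the model by their `Φ`-coordinate -/

/-- **`Π_X̲̲ := Π_C̲̲ ∩ Π_X = Φ⁻¹({y = −x} ⋊ 1)`**. (toy bookkeeping) [cite: MochizukiEtTh2009, Def 2.3 p.38] -/
theorem PiCuuK_inf_PiXK : PiCuuK l ⊓ PiXK l = (kumXuu l).comap (PhiK l) := by
  rw [PiCuuK, PiXK, ← Subgroup.comap_inf, kumCuu_inf_kumPiX]

/-- **`Π_X̲ := (Π_C̲̲ ∩ Π_X) · Δ̄_Θ-preimage = Φ⁻¹((ℤ/l)³ ⋊ 1)`**. (toy bookkeeping) [cite: MochizukiEtTh2009, Def 2.1 p.36] -/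
theorem PiXuuK_sup_barThetaK : (PiCuuK l ⊓ PiXK l) ⊔ barThetaK l = (kumH l).comap (PhiK l) := by
  rw [PiCuuK_inf_PiXK, barThetaK, Subgroup.comap_sup_eq _ _ _ (PhiK_surjective l), kumXuu_sup_kumZ]

/-- **`Π_C̲ := Π_C̲̲ · Δ̄_Θ-preimage = Φ⁻¹((ℤ/l)³ ⋊ {1, s r})`**. (toy bookkeeping) [cite: MochizukiEtTh2009, Def 2.1 p.36] -/
theorem PiCuuK_sup_barThetaK : PiCuuK l ⊔ barThetaK l = HpK l := by
  rw [PiCuuK, barThetaK, Subgroup.comap_sup_eq _ _ _ (PhiK_surjective l), kumCuu_sup_kumZ, HpK]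

end KummerModel

end ThetaCovers

end Literature.AnabelianGeometry.EtaleTheta
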